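import Summits.ValiantsHypothesis.ValiantsHypothesis.Theorems.LacunarySymmetroidMatrixDescartesDoorA26WallBubblingTwoScaleDoubletonSplit
import Summits.ValiantsHypothesis.ValiantsHypothesis.Theorems.LacunarySymmetroidMatrixDescartesDoorA26WallBubblingTwoPairTwoScaleMonotone

/-!
# Wall bubbling for `DoorA26` — TWO WEYL PAIRS, rung 2: SLOT SPLITTING FOR THE DOUBLETON CLASSES across two scales

HONEST FRAMING.  Chain lemma for obligation (W) `stub_weylFaces` of `Cruxes/DoorA26/Lines/wall_bubbling.lean` (stmt-ValiantsHypothesis-19979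
`DoorA26`; OPEN, typed, never asserted), W1 seat val-sym-door-p2 g13 (#47) — step 3 of the two-dslope port plan
`HOME/val-sym-door-p2/g13/TWO-DSLOPE-CHAIN-PORT.md` (rung 2 of 5).  W2's `twoScale_doubleton_split` (door-p1 g14) VERBATIM for the two-dslope frames
of W1 #25/#45/#46: at a two-Weyl-pair point (`δ0 5 = δ0 0`, `δ0 4 = δ0 1`) the doubleton values `δ₀ + δ_k`, `δ₁ + δ_k` (`k ∈ {2,3}` a single) have the
frame slots `(0,k)`/`(5,k)` resp. `(1,k)`/`(4,k)` (degrees 0/1); the `t`-slot is alive in AT MOST ONE of two cluster limits: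

* **`twoPair_doubleton_split₀₅`** — `Γ 5 k ≠ 0 → Γ' 5 k ≠ 0 → False`;  **`twoPair_doubleton_split₁₄`** — `Γ 4 k ≠ 0 → Γ' 4 k ≠ 0 → False`
  (hypotheses = those of `twoPair_twoScale_monotone`).  Mechanism = W2's (`eventually_dslope_exp_gt`; the transvection at the OTHER pair does not touch
  the slots `(0,k), (5,k)`: `frame_shift₂` at position `0` resp. `1`).

No new definitions; nothing here bears on `DoorA26`, `MatrixDescartes` (stmt-ValiantsHypothesis-18050) or `VP ≠ VNP`; the two-pair chains stay OPEN
(the triple rungs for the classes `2δ₀`, `2δ₁`, the new mixed-class rungs for `δ₀+δ₁`, and the assembly are not ported).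
`--supports stmt-ValiantsHypothesis-19979 --as helper`.  [this work = W2's rung 2, re-framed].
-/

-- `Summit.ValiantsHypothesis.ValiantsHypothesis.…` repeats a component by the D-0017 layout
-- (single-conjunct summit), which the `dupNamespace` linter flags; the name is mandated.
set_option linter.dupNamespace false

namespace Summit.ValiantsHypothesis.ValiantsHypothesis.Theorems.LacunarySymmetroidMatrixDescartes.WallBubbling

open Finset Filter Topology
open Bubbling (polar polar_apply polar_comm polar_smul_left_right)
open scoped BigOperators

/-- **SLOT SPLITTING FOR DOUBLETONS, pair `(0,5)` (two scales, two Weyl pairs).**  Same letters `U^ν` at two clusters at log-distance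
`L_ν → +∞` (hypotheses as in `twoPair_twoScale_monotone`); `k ∈ {2, 3}`.  The `t`-slot `(5,k)` of the doubleton value `δ₀ + δ_k` cannot be alive in
BOTH Gram-normalised limits. [this work = W2's rung 2, re-framed] -/
theorem twoPair_doubleton_split₀₅ (δs : ℕ → Fin 6 → ℝ) (δ0 : Fin 6 → ℝ)
    (hδ : ∀ l, Tendsto (fun ν => δs ν l) atTop (𝓝 (δ0 l))) (h50 : δ0 5 = δ0 0)
    (U : ℕ → Fin 6 → Matrix (Fin 2) (Fin 2) ℝ) (L : ℕ → ℝ) (hL : Tendsto L atTop atTop)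
    (μ μ' : ℕ → ℝ) (hμ : ∀ ν, 0 < μ ν) (hμ' : ∀ ν, 0 < μ' ν)
    (hdom : ∀ ν a b, |polar (if a = 0 then U ν 0 + U ν 5 else if a = 1 then U ν 1 + U ν 4
        else if a = 4 then (δs ν 4 - δs ν 1) • U ν 4 else if a = 5 then (δs ν 5 - δs ν 0) • U ν 5 else U ν a)
      (if b = 0 then U ν 0 + U ν 5 else if b = 1 then U ν 1 + U ν 4
        else if b = 4 then (δs ν 4 - δs ν 1) • U ν 4 else if b = 5 then (δs ν 5 - δs ν 0) • U ν 5 else U ν b)| ≤ μ ν)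
    (hdom' : ∀ ν a b, |polar
      (if a = 0 then Real.exp (δs ν 0 * L ν) • U ν 0 + Real.exp (δs ν 5 * L ν) • U ν 5
        else if a = 1 then Real.exp (δs ν 1 * L ν) • U ν 1 + Real.exp (δs ν 4 * L ν) • U ν 4
        else if a = 4 then (δs ν 4 - δs ν 1) • (Real.exp (δs ν 4 * L ν) • U ν 4)
        else if a = 5 then (δs ν 5 - δs ν 0) • (Real.exp (δs ν 5 * L ν) • U ν 5) else Real.exp (δs ν a * L ν) • U ν a)
      (if b = 0 then Real.exp (δs ν 0 * L ν) • U ν 0 + Real.exp (δs ν 5 * L ν) • U ν 5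
        else if b = 1 then Real.exp (δs ν 1 * L ν) • U ν 1 + Real.exp (δs ν 4 * L ν) • U ν 4
        else if b = 4 then (δs ν 4 - δs ν 1) • (Real.exp (δs ν 4 * L ν) • U ν 4)
        else if b = 5 then (δs ν 5 - δs ν 0) • (Real.exp (δs ν 5 * L ν) • U ν 5) else Real.exp (δs ν b * L ν) • U ν b)| ≤ μ' ν)
    (Γ Γ' : Fin 6 → Fin 6 → ℝ)
    (hΓ : ∀ a b, Tendsto (fun ν => polar (if a = 0 then U ν 0 + U ν 5 else if a = 1 then U ν 1 + U ν 4
        else if a = 4 then (δs ν 4 - δs ν 1) • U ν 4 else if a = 5 then (δs ν 5 - δs ν 0) • U ν 5 else U ν a)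
      (if b = 0 then U ν 0 + U ν 5 else if b = 1 then U ν 1 + U ν 4
        else if b = 4 then (δs ν 4 - δs ν 1) • U ν 4 else if b = 5 then (δs ν 5 - δs ν 0) • U ν 5 else U ν b) / μ ν) atTop (𝓝 (Γ a b)))
    (hΓ' : ∀ a b, Tendsto (fun ν => polar
      (if a = 0 then Real.exp (δs ν 0 * L ν) • U ν 0 + Real.exp (δs ν 5 * L ν) • U ν 5
        else if a = 1 then Real.exp (δs ν 1 * L ν) • U ν 1 + Real.exp (δs ν 4 * L ν) • U ν 4
        else if a = 4 then (δs ν 4 - δs ν 1) • (Real.exp (δs ν 4 * L ν) • U ν 4)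
        else if a = 5 then (δs ν 5 - δs ν 0) • (Real.exp (δs ν 5 * L ν) • U ν 5) else Real.exp (δs ν a * L ν) • U ν a)
      (if b = 0 then Real.exp (δs ν 0 * L ν) • U ν 0 + Real.exp (δs ν 5 * L ν) • U ν 5
        else if b = 1 then Real.exp (δs ν 1 * L ν) • U ν 1 + Real.exp (δs ν 4 * L ν) • U ν 4
        else if b = 4 then (δs ν 4 - δs ν 1) • (Real.exp (δs ν 4 * L ν) • U ν 4)
        else if b = 5 then (δs ν 5 - δs ν 0) • (Real.exp (δs ν 5 * L ν) • U ν 5) else Real.exp (δs ν b * L ν) • U ν b) / μ' ν)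
      atTop (𝓝 (Γ' a b)))
    (k : Fin 6) (hk0 : k ≠ 0) (hk1 : k ≠ 1) (hk4 : k ≠ 4) (hk5 : k ≠ 5) (h1 : Γ 5 k ≠ 0) (h2 : Γ' 5 k ≠ 0) : False := by
  set w : ℕ → ℝ := fun ν => δs ν 5 - δs ν 0 with hw
  set κ : ℝ := |Γ 5 k| / 2 with hκ
  set κ' : ℝ := |Γ' 5 k| / 2 with hκ'
  have hκpos : 0 < κ := by rw [hκ]; exact half_pos (abs_pos.mpr h1)
  have hκ'pos : 0 < κ' := by rw [hκ']; exact half_pos (abs_pos.mpr h2)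
  have h50' : ((5 : Fin 6) = 0) = False := by simp
  have h51' : ((5 : Fin 6) = 1) = False := by simp
  have h54' : ((5 : Fin 6) = 4) = False := by simp
  have h01' : ((0 : Fin 6) = 1) = False := by simp
  have h04' : ((0 : Fin 6) = 4) = False := by simp
  have h05' : ((0 : Fin 6) = 5) = False := by simp
  -- eventual aliveness
  have e1 : ∀ᶠ ν in atTop, κ * μ ν ≤ |polar ((δs ν 5 - δs ν 0) • U ν 5) (U ν k)| := by
    have h := ((hΓ 5 k).abs).eventually_const_lt (show κ < |Γ 5 k| by rw [hκ]; linarith [abs_pos.mpr h1])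
    filter_upwards [h] with ν hν
    simp only [h50', h51', h54', hk0, hk1, hk4, hk5, if_false, if_true] at hν
    rw [abs_div, abs_of_pos (hμ ν), lt_div_iff₀ (hμ ν)] at hν
    exact hν.le
  have e2 : ∀ᶠ ν in atTop, κ' * μ' ν ≤ |polar ((δs ν 5 - δs ν 0) • (Real.exp (δs ν 5 * L ν) • U ν 5)) (Real.exp (δs ν k * L ν) • U ν k)| := by
    have h := ((hΓ' 5 k).abs).eventually_const_lt (show κ' < |Γ' 5 k| by rw [hκ']; linarith [abs_pos.mpr h2])
    filter_upwards [h] with ν hν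
    simp only [h50', h51', h54', hk0, hk1, hk4, hk5, if_false, if_true] at hν
    rw [abs_div, abs_of_pos (hμ' ν), lt_div_iff₀ (hμ' ν)] at hν
    exact hν.le
  have hw0 : Tendsto w atTop (𝓝 0) := by
    have := (hδ 5).sub (hδ 0)
    rw [h50, sub_self] at this
    exact this
  have e3 := eventually_dslope_exp_gt w L hw0 hL (1 / κ') (1 / κ) (by positivity) (by positivity)
  have hfalse : ∀ᶠ ν : ℕ in atTop, False := by
    filter_upwards [e1, e2, e3] with ν hν1 hν2 hν3
    -- the two frame entries of the doubleton at the first scale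
    set gB : ℝ := polar ((δs ν 5 - δs ν 0) • U ν 5) (U ν k) with hgB
    set gA : ℝ := polar (U ν 0 + U ν 5) (U ν k) with hgA
    set Λ : ℝ := dslope (fun y : ℝ => Real.exp (y * L ν)) 0 (δs ν 5 - δs ν 0) with hΛ
    have hgAle : |gA| ≤ μ ν := by
      have := hdom ν 0 k
      simp only [hk0, hk1, hk4, hk5, if_false, if_true] at this
      exact this
    -- the same entries at the second scale, via `frame_shift`
    have hB' : polar ((δs ν 5 - δs ν 0) • (Real.exp (δs ν 5 * L ν) • U ν 5)) (Real.exp (δs ν k * L ν) • U ν k)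
        = Real.exp (δs ν 5 * L ν) * Real.exp (δs ν k * L ν) * gB := by
      rw [smul_comm, polar_smul_left_right]
    have hA' : polar (Real.exp (δs ν 0 * L ν) • U ν 0 + Real.exp (δs ν 5 * L ν) • U ν 5) (Real.exp (δs ν k * L ν) • U ν k)
        = Real.exp (δs ν 0 * L ν) * Real.exp (δs ν k * L ν) * (gA + Λ * gB) := by
      have hs := frame_shift₂ (δs ν) (U ν) (L ν) 0
      simp only [h01', h04', h05', if_true, if_false, zero_smul, add_zero] at hs
      rw [hs, show Real.exp (δs ν k * L ν) • U ν k = Real.exp (δs ν k * L ν) • (U ν k + (0 : ℝ) • ((δs ν 5 - δs ν 0) • U ν 5)) by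
        rw [zero_smul, add_zero], polar_shift_expand]
      rw [hgA, hgB, hΛ]
      ring
    have hA'le : |polar (Real.exp (δs ν 0 * L ν) • U ν 0 + Real.exp (δs ν 5 * L ν) • U ν 5) (Real.exp (δs ν k * L ν) • U ν k)| ≤ μ' ν := by
      have := hdom' ν 0 k
      simp only [hk0, hk1, hk4, hk5, if_false, if_true] at this
      exact this
    -- `κ' μ' ≤ |gB'| = e^{(δ5+δk)L}|gB|` and `e^{(δ0+δk)L}|gA + Λ gB| ≤ μ'`
    rw [hB'] at hν2
    rw [hA'] at hA'le
    have hgBpos : 0 < |gB| := lt_of_lt_of_le (mul_pos hκpos (hμ ν)) hν1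
    -- |Λ| |gB| ≤ |gA| + e^{wL} |gB| / κ'
    have hE0 : 0 < Real.exp (δs ν 0 * L ν) * Real.exp (δs ν k * L ν) := mul_pos (Real.exp_pos _) (Real.exp_pos _)
    have hkey1 : |gA + Λ * gB| ≤ Real.exp (w ν * L ν) * |gB| / κ' := by
      -- from hA'le and hν2
      rw [abs_mul, abs_of_pos hE0] at hA'le
      rw [abs_mul, abs_of_pos (mul_pos (Real.exp_pos _) (Real.exp_pos _))] at hν2
      have hμ'le : μ' ν ≤ Real.exp (δs ν 5 * L ν) * Real.exp (δs ν k * L ν) * |gB| / κ' := by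
        rw [le_div_iff₀ hκ'pos]; linarith
      have : Real.exp (δs ν 0 * L ν) * Real.exp (δs ν k * L ν) * |gA + Λ * gB|
          ≤ Real.exp (δs ν 0 * L ν) * Real.exp (δs ν k * L ν) * (Real.exp (w ν * L ν) * |gB| / κ') := by
        calc _ ≤ μ' ν := hA'le
          _ ≤ Real.exp (δs ν 5 * L ν) * Real.exp (δs ν k * L ν) * |gB| / κ' := hμ'le
          _ = Real.exp (δs ν 0 * L ν) * Real.exp (δs ν k * L ν) * (Real.exp (w ν * L ν) * |gB| / κ') := by
              rw [hw]
              simp only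
              rw [show δs ν 5 * L ν = δs ν 0 * L ν + (δs ν 5 - δs ν 0) * L ν by ring, Real.exp_add]
              ring
      exact le_of_mul_le_mul_left this hE0
    have hkey2 : |Λ| * |gB| ≤ |gA| + Real.exp (w ν * L ν) * |gB| / κ' := by
      have t : |Λ * gB| ≤ |gA + Λ * gB| + |gA| := by
        have := abs_sub_le (Λ * gB) (gA + Λ * gB) 0
        have h' : |Λ * gB - (gA + Λ * gB)| = |gA| := by rw [show Λ * gB - (gA + Λ * gB) = -gA by ring, abs_neg]
        have := abs_add_le (gA + Λ * gB) (-gA)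
        rw [show gA + Λ * gB + -gA = Λ * gB by ring, abs_neg] at this
        linarith
      rw [← abs_mul]
      linarith
    -- divide by |gB| and use |gA| ≤ μ ≤ |gB|/κ
    have hkey3 : |Λ| ≤ 1 / κ' * Real.exp (w ν * L ν) + 1 / κ := by
      have hμle : μ ν ≤ |gB| / κ := by rw [le_div_iff₀ hκpos]; linarith
      have : |Λ| * |gB| ≤ (1 / κ' * Real.exp (w ν * L ν) + 1 / κ) * |gB| := by
        calc |Λ| * |gB| ≤ |gA| + Real.exp (w ν * L ν) * |gB| / κ' := hkey2
          _ ≤ |gB| / κ + Real.exp (w ν * L ν) * |gB| / κ' := by linarith [le_trans hgAle hμle]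
          _ = (1 / κ' * Real.exp (w ν * L ν) + 1 / κ) * |gB| := by ring
      exact le_of_mul_le_mul_right this hgBpos
    exact absurd (lt_of_le_of_lt hkey3 hν3) (lt_irrefl _)
  exact hfalse.exists.elim fun _ h => h

/-- **SLOT SPLITTING FOR DOUBLETONS, pair `(1,4)`** — the mirror statement for the `t`-slot `(4,k)` of the value `δ₁ + δ_k`, `k ∈ {2,3}`.
[this work = W2's rung 2, re-framed] -/
theorem twoPair_doubleton_split₁₄ (δs : ℕ → Fin 6 → ℝ) (δ0 : Fin 6 → ℝ)
    (hδ : ∀ l, Tendsto (fun ν => δs ν l) atTop (𝓝 (δ0 l))) (h41 : δ0 4 = δ0 1)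
    (U : ℕ → Fin 6 → Matrix (Fin 2) (Fin 2) ℝ) (L : ℕ → ℝ) (hL : Tendsto L atTop atTop)
    (μ μ' : ℕ → ℝ) (hμ : ∀ ν, 0 < μ ν) (hμ' : ∀ ν, 0 < μ' ν)
    (hdom : ∀ ν a b, |polar (if a = 0 then U ν 0 + U ν 5 else if a = 1 then U ν 1 + U ν 4
        else if a = 4 then (δs ν 4 - δs ν 1) • U ν 4 else if a = 5 then (δs ν 5 - δs ν 0) • U ν 5 else U ν a)
      (if b = 0 then U ν 0 + U ν 5 else if b = 1 then U ν 1 + U ν 4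
        else if b = 4 then (δs ν 4 - δs ν 1) • U ν 4 else if b = 5 then (δs ν 5 - δs ν 0) • U ν 5 else U ν b)| ≤ μ ν)
    (hdom' : ∀ ν a b, |polar
      (if a = 0 then Real.exp (δs ν 0 * L ν) • U ν 0 + Real.exp (δs ν 5 * L ν) • U ν 5
        else if a = 1 then Real.exp (δs ν 1 * L ν) • U ν 1 + Real.exp (δs ν 4 * L ν) • U ν 4
        else if a = 4 then (δs ν 4 - δs ν 1) • (Real.exp (δs ν 4 * L ν) • U ν 4)
        else if a = 5 then (δs ν 5 - δs ν 0) • (Real.exp (δs ν 5 * L ν) • U ν 5) else Real.exp (δs ν a * L ν) • U ν a)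
      (if b = 0 then Real.exp (δs ν 0 * L ν) • U ν 0 + Real.exp (δs ν 5 * L ν) • U ν 5
        else if b = 1 then Real.exp (δs ν 1 * L ν) • U ν 1 + Real.exp (δs ν 4 * L ν) • U ν 4
        else if b = 4 then (δs ν 4 - δs ν 1) • (Real.exp (δs ν 4 * L ν) • U ν 4)
        else if b = 5 then (δs ν 5 - δs ν 0) • (Real.exp (δs ν 5 * L ν) • U ν 5) else Real.exp (δs ν b * L ν) • U ν b)| ≤ μ' ν)
    (Γ Γ' : Fin 6 → Fin 6 → ℝ)
    (hΓ : ∀ a b, Tendsto (fun ν => polar (if a = 0 then U ν 0 + U ν 5 else if a = 1 then U ν 1 + U ν 4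
        else if a = 4 then (δs ν 4 - δs ν 1) • U ν 4 else if a = 5 then (δs ν 5 - δs ν 0) • U ν 5 else U ν a)
      (if b = 0 then U ν 0 + U ν 5 else if b = 1 then U ν 1 + U ν 4
        else if b = 4 then (δs ν 4 - δs ν 1) • U ν 4 else if b = 5 then (δs ν 5 - δs ν 0) • U ν 5 else U ν b) / μ ν) atTop (𝓝 (Γ a b)))
    (hΓ' : ∀ a b, Tendsto (fun ν => polar
      (if a = 0 then Real.exp (δs ν 0 * L ν) • U ν 0 + Real.exp (δs ν 5 * L ν) • U ν 5
        else if a = 1 then Real.exp (δs ν 1 * L ν) • U ν 1 + Real.exp (δs ν 4 * L ν) • U ν 4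
        else if a = 4 then (δs ν 4 - δs ν 1) • (Real.exp (δs ν 4 * L ν) • U ν 4)
        else if a = 5 then (δs ν 5 - δs ν 0) • (Real.exp (δs ν 5 * L ν) • U ν 5) else Real.exp (δs ν a * L ν) • U ν a)
      (if b = 0 then Real.exp (δs ν 0 * L ν) • U ν 0 + Real.exp (δs ν 5 * L ν) • U ν 5
        else if b = 1 then Real.exp (δs ν 1 * L ν) • U ν 1 + Real.exp (δs ν 4 * L ν) • U ν 4
        else if b = 4 then (δs ν 4 - δs ν 1) • (Real.exp (δs ν 4 * L ν) • U ν 4)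
        else if b = 5 then (δs ν 5 - δs ν 0) • (Real.exp (δs ν 5 * L ν) • U ν 5) else Real.exp (δs ν b * L ν) • U ν b) / μ' ν)
      atTop (𝓝 (Γ' a b)))
    (k : Fin 6) (hk0 : k ≠ 0) (hk1 : k ≠ 1) (hk4 : k ≠ 4) (hk5 : k ≠ 5) (h1 : Γ 4 k ≠ 0) (h2 : Γ' 4 k ≠ 0) : False := by
  set w : ℕ → ℝ := fun ν => δs ν 4 - δs ν 1 with hw
  set κ : ℝ := |Γ 4 k| / 2 with hκ
  set κ' : ℝ := |Γ' 4 k| / 2 with hκ'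
  have hκpos : 0 < κ := by rw [hκ]; exact half_pos (abs_pos.mpr h1)
  have hκ'pos : 0 < κ' := by rw [hκ']; exact half_pos (abs_pos.mpr h2)
  have h40' : ((4 : Fin 6) = 0) = False := by simp
  have h41' : ((4 : Fin 6) = 1) = False := by simp
  have h10' : ((1 : Fin 6) = 0) = False := by simp
  have h14' : ((1 : Fin 6) = 4) = False := by simp
  have h15' : ((1 : Fin 6) = 5) = False := by simp
  -- eventual aliveness
  have e1 : ∀ᶠ ν in atTop, κ * μ ν ≤ |polar ((δs ν 4 - δs ν 1) • U ν 4) (U ν k)| := by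
    have h := ((hΓ 4 k).abs).eventually_const_lt (show κ < |Γ 4 k| by rw [hκ]; linarith [abs_pos.mpr h1])
    filter_upwards [h] with ν hν
    simp only [h40', h41', hk0, hk1, hk4, hk5, if_false, if_true] at hν
    rw [abs_div, abs_of_pos (hμ ν), lt_div_iff₀ (hμ ν)] at hν
    exact hν.le
  have e2 : ∀ᶠ ν in atTop, κ' * μ' ν ≤ |polar ((δs ν 4 - δs ν 1) • (Real.exp (δs ν 4 * L ν) • U ν 4)) (Real.exp (δs ν k * L ν) • U ν k)| := by
    have h := ((hΓ' 4 k).abs).eventually_const_lt (show κ' < |Γ' 4 k| by rw [hκ']; linarith [abs_pos.mpr h2])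
    filter_upwards [h] with ν hν
    simp only [h40', h41', hk0, hk1, hk4, hk5, if_false, if_true] at hν
    rw [abs_div, abs_of_pos (hμ' ν), lt_div_iff₀ (hμ' ν)] at hν
    exact hν.le
  have hw0 : Tendsto w atTop (𝓝 0) := by
    have := (hδ 4).sub (hδ 1)
    rw [h41, sub_self] at this
    exact this
  have e3 := eventually_dslope_exp_gt w L hw0 hL (1 / κ') (1 / κ) (by positivity) (by positivity)
  have hfalse : ∀ᶠ ν : ℕ in atTop, False := by
    filter_upwards [e1, e2, e3] with ν hν1 hν2 hν3
    -- the two frame entries of the doubleton at the first scale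
    set gB : ℝ := polar ((δs ν 4 - δs ν 1) • U ν 4) (U ν k) with hgB
    set gA : ℝ := polar (U ν 1 + U ν 4) (U ν k) with hgA
    set Λ : ℝ := dslope (fun y : ℝ => Real.exp (y * L ν)) 0 (δs ν 4 - δs ν 1) with hΛ
    have hgAle : |gA| ≤ μ ν := by
      have := hdom ν 1 k
      simp only [h10', hk0, hk1, hk4, hk5, if_false, if_true] at this
      exact this
    -- the same entries at the second scale, via `frame_shift`
    have hB' : polar ((δs ν 4 - δs ν 1) • (Real.exp (δs ν 4 * L ν) • U ν 4)) (Real.exp (δs ν k * L ν) • U ν k)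
        = Real.exp (δs ν 4 * L ν) * Real.exp (δs ν k * L ν) * gB := by
      rw [smul_comm, polar_smul_left_right]
    have hA' : polar (Real.exp (δs ν 1 * L ν) • U ν 1 + Real.exp (δs ν 4 * L ν) • U ν 4) (Real.exp (δs ν k * L ν) • U ν k)
        = Real.exp (δs ν 1 * L ν) * Real.exp (δs ν k * L ν) * (gA + Λ * gB) := by
      have hs := frame_shift₂ (δs ν) (U ν) (L ν) 1
      simp only [h10', h14', h15', if_true, if_false, zero_smul, add_zero] at hs
      rw [hs, show Real.exp (δs ν k * L ν) • U ν k = Real.exp (δs ν k * L ν) • (U ν k + (0 : ℝ) • ((δs ν 4 - δs ν 1) • U ν 4)) by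
        rw [zero_smul, add_zero], polar_shift_expand]
      rw [hgA, hgB, hΛ]
      ring
    have hA'le : |polar (Real.exp (δs ν 1 * L ν) • U ν 1 + Real.exp (δs ν 4 * L ν) • U ν 4) (Real.exp (δs ν k * L ν) • U ν k)| ≤ μ' ν := by
      have := hdom' ν 1 k
      simp only [h10', hk0, hk1, hk4, hk5, if_false, if_true] at this
      exact this
    -- `κ' μ' ≤ |gB'| = e^{(δ5+δk)L}|gB|` and `e^{(δ0+δk)L}|gA + Λ gB| ≤ μ'`
    rw [hB'] at hν2
    rw [hA'] at hA'le
    have hgBpos : 0 < |gB| := lt_of_lt_of_le (mul_pos hκpos (hμ ν)) hν1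
    -- |Λ| |gB| ≤ |gA| + e^{wL} |gB| / κ'
    have hE0 : 0 < Real.exp (δs ν 1 * L ν) * Real.exp (δs ν k * L ν) := mul_pos (Real.exp_pos _) (Real.exp_pos _)
    have hkey1 : |gA + Λ * gB| ≤ Real.exp (w ν * L ν) * |gB| / κ' := by
      -- from hA'le and hν2
      rw [abs_mul, abs_of_pos hE0] at hA'le
      rw [abs_mul, abs_of_pos (mul_pos (Real.exp_pos _) (Real.exp_pos _))] at hν2
      have hμ'le : μ' ν ≤ Real.exp (δs ν 4 * L ν) * Real.exp (δs ν k * L ν) * |gB| / κ' := by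
        rw [le_div_iff₀ hκ'pos]; linarith
      have : Real.exp (δs ν 1 * L ν) * Real.exp (δs ν k * L ν) * |gA + Λ * gB|
          ≤ Real.exp (δs ν 1 * L ν) * Real.exp (δs ν k * L ν) * (Real.exp (w ν * L ν) * |gB| / κ') := by
        calc _ ≤ μ' ν := hA'le
          _ ≤ Real.exp (δs ν 4 * L ν) * Real.exp (δs ν k * L ν) * |gB| / κ' := hμ'le
          _ = Real.exp (δs ν 1 * L ν) * Real.exp (δs ν k * L ν) * (Real.exp (w ν * L ν) * |gB| / κ') := by
              rw [hw]
              simp only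
              rw [show δs ν 4 * L ν = δs ν 1 * L ν + (δs ν 4 - δs ν 1) * L ν by ring, Real.exp_add]
              ring
      exact le_of_mul_le_mul_left this hE0
    have hkey2 : |Λ| * |gB| ≤ |gA| + Real.exp (w ν * L ν) * |gB| / κ' := by
      have t : |Λ * gB| ≤ |gA + Λ * gB| + |gA| := by
        have := abs_sub_le (Λ * gB) (gA + Λ * gB) 0
        have h' : |Λ * gB - (gA + Λ * gB)| = |gA| := by rw [show Λ * gB - (gA + Λ * gB) = -gA by ring, abs_neg]
        have := abs_add_le (gA + Λ * gB) (-gA)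
        rw [show gA + Λ * gB + -gA = Λ * gB by ring, abs_neg] at this
        linarith
      rw [← abs_mul]
      linarith
    -- divide by |gB| and use |gA| ≤ μ ≤ |gB|/κ
    have hkey3 : |Λ| ≤ 1 / κ' * Real.exp (w ν * L ν) + 1 / κ := by
      have hμle : μ ν ≤ |gB| / κ := by rw [le_div_iff₀ hκpos]; linarith
      have : |Λ| * |gB| ≤ (1 / κ' * Real.exp (w ν * L ν) + 1 / κ) * |gB| := by
        calc |Λ| * |gB| ≤ |gA| + Real.exp (w ν * L ν) * |gB| / κ' := hkey2
          _ ≤ |gB| / κ + Real.exp (w ν * L ν) * |gB| / κ' := by linarith [le_trans hgAle hμle]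
          _ = (1 / κ' * Real.exp (w ν * L ν) + 1 / κ) * |gB| := by ring
      exact le_of_mul_le_mul_right this hgBpos
    exact absurd (lt_of_le_of_lt hkey3 hν3) (lt_irrefl _)
  exact hfalse.exists.elim fun _ h => h

end Summit.ValiantsHypothesis.ValiantsHypothesis.Theorems.LacunarySymmetroidMatrixDescartes.WallBubbling
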